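import Summits.BirchSwinnertonDyer.BirchSwinnertonDyer.Theorems.CumulativeHeegnerLeopoldtCumulativeHeegnerInclusionAtThreeTraceZeroHeegnerModule
import Summits.BirchSwinnertonDyer.BirchSwinnertonDyer.Theorems.CumulativeHeegnerLeopoldtCumulativeHeegnerInclusionAtThreeCumulativeKummerTower
import Summits.BirchSwinnertonDyer.Rank1Residual.Additive.KatoDescentRankOneCountContraOfFacts
import Literature.NumberTheory.EllipticCurves.HeegnerGeomLevelDividingRelationProofs
import Literature.NumberTheory.EllipticCurves.HeegnerTraceRelationLevelDividingSplitProofs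
import HarnessLib

/-!
# Crux K1 `CumulativeHeegnerInclusionAtThree` (stmt-BirchSwinnertonDyer-24198), line `birth` — the objects of
# STUB A on the Leopoldt cell: the CANONICAL Heegner family of `3`-power conductor has trace ZERO up the
# anticyclotomic tower (`a₃ = 0`), hence its `Λ`-adic Heegner module is `⊥` — now WITHOUT the Cornut–Vatsal
# named fact (modulo the classical tower containment `K_k ⊆ K[3^{k+1}]` only)

Width seat bsd-line-chl-k1-p1-w2 g9 (`--supports stmt-BirchSwinnertonDyer-24198`). STUB A of line `birth`
(= crux stmt-BirchSwinnertonDyer-26896 `TemperedHeegnerInclusionAtThree`) is built on «the cumulative Heegner class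
`κ♮` (norm-compatible because `a₃ = 0 ⇒ Tr y_(3^(k+1)) = 0)`»; the lead's BARRIER memo (A26896 §3/§3b) recorded the
OBJECT DEFICIT «CM points of `3`-power conductor at `9 ∣ N` with torsion traces» and typed its printed source as the
named fact `CornutVatsal2007.exists_heegnerFamily_traceTorsion_of_sq_dvd` (clause (i) Lemma 4.9 (iii) / 6.14:
torsion traces; clause (ii) Thm. 1.10: non-triviality). The EXISTENCE of the family became a theorem in
`HeegnerNormPointExistenceAnyConductorProofs` (p640007); this file makes clause (i) — the RELATIONS — a theorem
as well, in the exact (not merely torsion) form, for the canonical family: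

* §1 `cell_three_dvd`, `cell_lFunction_three_eq_zero` — on the cell (class O6 at `3`: additive), `3 ∣ N` and
  `a₃(W) = 0` (`ContraCount.lFunction_eq_zero_of_addv`).
* §2 `cell_exists_heegnerFamily_trace_eq_zero` — for `K` imaginary quadratic, `N = N_E`, every `ℤ₃`-extension `κ`
  with topological generator `γ` satisfying the tower containment `Gal(K̄/K[3^{k+1}]) ≤ Gal(K̄/K_k)` (Howard 2004
  §3.3 `K_k ⊂ K[p^{k+1}]`; classical class field theory — the tree's standing binder, cf. the route decl
  `PrintX9.AnticyclotomicTowerSharp`; NOT proved here), every datum `Dt`, orientation `β` and embedding `jbar`: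
  there is a Heegner family `F` (the canonical one of `exists_heegnerFamily_canonical`) with `F.Dt = Dt`,
  `F.β = β` and `∑_{i<3} γ^{3^j i} • z_{j+1} = 0` for EVERY `j`
  (`HeegnerGeomLevelDividing.exists_heegnerFamily_trace_eq_zero`: `Tr_{K_{j+1}/K_j} z_{j+1} = a₃ • z_j = 0`); and the
  torsion form `∃ m ≠ 0, m • Tr = 0` (`m = 1`) = hypothesis `hTT` of `…TraceZero.heegnerModule_eq_bot_of_traceTorsion`.
* §3 `cell_exists_heegnerFamily_heegnerModule_eq_bot` — consequently, on the Leopoldt cell (non-anomalous rational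
  line, Heegner hypothesis) the `Λ`-adic Heegner module `ℋ_∞(F)` of that family is `⊥` for EVERY `Λ`-adic Selmer
  datum `D` (`…TraceZero.heegnerModule_eq_bot_on_leopoldtCell`, p622174, whose hypothesis `hTZ` is now discharged):
  the DEGENERACY of the `Λ`-adic Heegner module at `9 ∣ N` (census A26896 §2 row 1) holds print-free up to the tower
  containment.
* §4 `cell_exists_cumulativeKummerTower_canonical` — and the CUMULATIVE KUMMER TOWER of p641582
  (`…CumulativeKummerTower.exists_cumulativeKummerTower`: Kummer families `c♮_k ∈ S₃(E/K_k)` of `Y_k = z_0 + ⋯ + z_k`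
  with `Σ_{i<3} conj_{γ^{3^k i}} c♮_{k+1} = res(3 • c♮_k)`, temper exactly `1`) exists for the canonical family from the
  bottom layer `j₀ = 0`, WITHOUT the Cornut–Vatsal fact (modulo the tower containment) — the raw object `κ♮` of the
  crux text.
* §5 (appended) `cell_discr_lt_neg_four`; `cell_exists_heegnerFamily_canonical_relations` — ONE family with ALL
  relations: the bottom `z_0 = −y_K` (`HeegnerTraceLevelDividingSplit.z_zero_eq_lFunction_smul_y_sub_y`, `a₃ = 0`; no
  tower hypothesis; so the bottom of the cumulative tower is non-torsion exactly when `y_K` is — Gross–Zagier), the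
  layer traces `= 0`, and `ℋ_∞(F) = ⊥`.

What this does NOT do: clause (ii) (Mazur / Cornut–Vatsal non-triviality of the `z_j`, Thm. 1.10) stays print;
nothing here touches the research stubs [R-KS] / [R-rec] of A; K1 and A stay OPEN. THEOREMS ONLY; no definition,
no `sorry`; imports no `Theses` module. BSD is not proved by any of this.

References: [CornutVatsal2007] Lemma 4.9 (iii), Lemma 6.14, Thm. 1.10; [Howard2004HeegnerKolyvagin] §3.3;
[PerrinRiou1987BSMF] §3.3–3.4; [Castella2018Erratum] Lemma 2.1.
-/

set_option autoImplicit false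
-- `…BirchSwinnertonDyer.BirchSwinnertonDyer.Theorems…` is the problem's mandated namespace (D-0017).
set_option linter.dupNamespace false

noncomputable section

open scoped Classical

namespace Summit.BirchSwinnertonDyer.BirchSwinnertonDyer.Theorems.CumulativeHeegnerInclusionAtThreeCanonicalFamilyTraceZero

open WeierstrassCurve Literature.NumberTheory.EllipticCurves Literature.NumberTheory.EllipticCurves.ModularForms
  Summit.BirchSwinnertonDyer.Rank1Residual.Additive
  Summit.BirchSwinnertonDyer.BirchSwinnertonDyer.Theorems.CumulativeHeegnerInclusionAtThreeTraceZero

variable {K₀ : Type} [Field K₀] [NumberField K₀] {W₀ : WeierstrassCurve ℚ} [W₀.IsElliptic] [W₀.IsGloballyMinimal]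
  {N₀ : ℕ} [NeZero N₀]

/-! ## §1 The cell at `3`: `3 ∣ N` and `a₃ = 0` -/

omit [W₀.IsGloballyMinimal] [NeZero N₀] in
/-- On the cell (class O6 at `3`, i.e. `3` odd and ADDITIVE for `W`), `3 ∣ N = N_E`. [cite: SilvermanAEC2009, VII.5 Prop. 5.1 (additive ⇒ bad)] -/
theorem cell_three_dvd (hO6 : ClassO6 W₀ 3) (hN : W₀.conductorNorm ℤ = N₀) : 3 ∣ N₀ := by
  rw [← hN]
  exact (W₀.dvd_conductorNorm_iff_not_hasGoodReductionAtPrime 3).mpr hO6.2.1.1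

omit [W₀.IsGloballyMinimal] in
/-- On the cell (additive reduction at `3`), `a₃(W) = W.LFunction 3 = 0` (the Euler factor at `3` is `1`).
[cite: SilvermanAEC2009, §C.16 (L_v(T) = 1 at an additive place)] -/
theorem cell_lFunction_three_eq_zero (hO6 : ClassO6 W₀ 3) : W₀.LFunction 3 = 0 :=
  ContraCount.lFunction_eq_zero_of_addv W₀ 3 hO6.2.1

/-! ## §2 The canonical family has trace ZERO up the tower -/

omit [W₀.IsGloballyMinimal] in
/-- **The canonical Heegner family of `3`-power conductor on the cell has `Tr_{K_{j+1}/K_j} z_{j+1} = 0` for every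
`j`** (modulo the tower containment `K_k ⊆ K[3^{k+1}]`): `Tr z_{j+1} = a₃ • z_j`
(`HeegnerGeomLevelDividing.exists_heegnerFamily_trace_eq_lFunction_smul`, the `U₃`-relation of the CM points of
`3`-power conductor at `3 ∣ N`) and `a₃ = 0`. Also in the torsion currency `∃ m ≠ 0, m • Tr = 0` (`m = 1`), the
hypothesis `hTT` of `…TraceZero.heegnerModule_eq_bot_of_traceTorsion` — clause (i) of
`CornutVatsal2007.exists_heegnerFamily_traceTorsion_of_sq_dvd` PROVED for this family (every `j`, `j₀ = 0`).
[cite: CornutVatsal2007, §4.3 Lemma 4.9 (iii) and §6.4 Lemma 6.14] [cite: Howard2004HeegnerKolyvagin, §3.3 (K_k ⊂ K[p^{k+1}])] -/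
theorem cell_exists_heegnerFamily_trace_eq_zero (hO6 : ClassO6 W₀ 3) (hN : W₀.conductorNorm ℤ = N₀)
    (hK : IsImaginaryQuadratic K₀) (κ₃ : ZpExtension K₀ 3) {γ₃ : Field.absoluteGaloisGroup K₀}
    (hγ : κ₃.IsTopGenerator γ₃) (Dt : ModularParametrizationData W₀ N₀) {β : ℤ}
    (hβ : (4 * N₀ : ℤ) ∣ β ^ 2 - NumberField.discr K₀) (jbar₀ : AlgebraicClosure K₀ →+* ℂ)
    (hTw : ∀ k : ℕ, ringClassSubgroup K₀ (3 ^ (k + 1)) jbar₀ ≤ κ₃.layerSubgroup k) :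
    ∃ F : HeegnerFamily N₀ W₀ K₀ κ₃ jbar₀, F.Dt = Dt ∧ F.β = β ∧
      (∀ j : ℕ, ∑ i ∈ Finset.range 3, (γ₃ ^ (3 ^ j * i)) • F.z (j + 1) = 0) ∧
      ∀ j : ℕ, ∃ m : ℤ, m ≠ 0 ∧ m • (∑ i ∈ Finset.range 3, (γ₃ ^ (3 ^ j * i)) • F.z (j + 1)) = 0 := by
  obtain ⟨F, hFDt, hFβ, htr⟩ := HeegnerGeomLevelDividing.exists_heegnerFamily_trace_eq_zero hK κ₃ hγ Dt hβ jbar₀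
    (cell_three_dvd hO6 hN) (cell_lFunction_three_eq_zero hO6) hTw
  exact ⟨F, hFDt, hFβ, htr, fun j ↦ ⟨1, one_ne_zero, by rw [htr j, smul_zero]⟩⟩

/-! ## §3 Hence its `Λ`-adic Heegner module is `⊥` on the Leopoldt cell -/

/-- **DEGENERACY of the `Λ`-adic Heegner module on the Leopoldt cell, print-free up to the tower containment.**
On the cell of crux K1 / A (class O6 at `3`, NON-ANOMALOUS rational line, `K` imaginary quadratic Heegner for
`N = N_E`), for every `ℤ₃`-extension `κ` with topological generator `γ` satisfying `K_k ⊆ K[3^{k+1}]` for all `k`,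
every datum `Dt`, orientation `β`, embedding `jbar`: the canonical Heegner family `F` (`F.Dt = Dt`, `F.β = β`) has
trace zero up the tower AND `ℋ_∞(F) = ⊥` for EVERY `Λ`-adic Selmer datum `D`
(`…TraceZero.heegnerModule_eq_bot_on_leopoldtCell`, p622174, its `hTZ` discharged by §2). Previously this conclusion
consumed clause (i) of the Cornut–Vatsal named fact. [cite: PerrinRiou1987BSMF, §3.4 Prop. 10]
[cite: Castella2018Erratum, Lemma 2.1] [cite: CornutVatsal2007, §4.3 Lemma 4.9 (iii)] -/
theorem cell_exists_heegnerFamily_heegnerModule_eq_bot (hO6 : ClassO6 W₀ 3)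
    (hline : ∃ Φ : AddSubgroup (WeierstrassCurve.geomTorsion W₀ ((3 : ℕ) : ℤ)),
        Literature.NumberTheory.EllipticCurves.Rank1Residual.IsRationalLine W₀ 3 Φ ∧
        ∀ (v : IsDedekindDomain.HeightOneSpectrum (NumberField.RingOfIntegers ℚ)),
          ((3 : ℕ) : NumberField.RingOfIntegers ℚ) ∈ v.asIdeal → ∀ 𝔓 ∈ v.primesAbove,
          ¬ (∀ g ∈ 𝔓.decompositionSubgroup (Field.absoluteGaloisGroup ℚ), ∀ P ∈ Φ, g • P = P) ∧
          ¬ (∀ g ∈ 𝔓.decompositionSubgroup (Field.absoluteGaloisGroup ℚ),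
              ∀ P : WeierstrassCurve.geomTorsion W₀ ((3 : ℕ) : ℤ), g • P - P ∈ Φ))
    (hN : W₀.conductorNorm ℤ = N₀) (hK : IsImaginaryQuadratic K₀) (hHg : SatisfiesHeegnerHypothesis N₀ K₀)
    (κ₃ : ZpExtension K₀ 3) {γ₃ : Field.absoluteGaloisGroup K₀} (hγ : κ₃.IsTopGenerator γ₃)
    (Dt : ModularParametrizationData W₀ N₀) {β : ℤ} (hβ : (4 * N₀ : ℤ) ∣ β ^ 2 - NumberField.discr K₀)
    (jbar₀ : AlgebraicClosure K₀ →+* ℂ)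
    (hTw : ∀ k : ℕ, ringClassSubgroup K₀ (3 ^ (k + 1)) jbar₀ ≤ κ₃.layerSubgroup k) :
    ∃ F : HeegnerFamily N₀ W₀ K₀ κ₃ jbar₀, F.Dt = Dt ∧ F.β = β ∧
      (∀ j : ℕ, ∑ i ∈ Finset.range 3, (γ₃ ^ (3 ^ j * i)) • F.z (j + 1) = 0) ∧
      ∀ D : (W₀.baseChange K₀).LambdaAdicSelmerData κ₃ γ₃, heegnerModule D F = ⊥ := by
  obtain ⟨F, hFDt, hFβ, htr, -⟩ := cell_exists_heegnerFamily_trace_eq_zero hO6 hN hK κ₃ hγ Dt hβ jbar₀ hTw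
  exact ⟨F, hFDt, hFβ, htr, fun D ↦ heegnerModule_eq_bot_on_leopoldtCell hO6 hline hN hK hHg hγ D F htr⟩

/-! ## §4 The cumulative Kummer tower of the canonical family, from the bottom layer, without Cornut–Vatsal -/

/-- **THE CUMULATIVE KUMMER TOWER OF THE CANONICAL FAMILY ON THE LEOPOLDT CELL, print-free up to the tower
containment.** On the cell (class O6 at `3`, non-anomalous rational line, `N = N_E`, `K` imaginary quadratic Heegner
for `N`), for every `ℤ₃`-extension `κ` with topological generator `γ` and `K_k ⊆ K[3^{k+1}]` for all `k`, every `Dt`,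
`β`, `jbar`: the canonical Heegner family `F` (`F.Dt = Dt`, `F.β = β`) carries compact Selmer elements
`c♮_k ∈ S₃(E/K_k)` — the Kummer families of the CUMULATIVE points `Y_k = z_0 + ⋯ + z_k` — with
`Σ_{i<3} conj_{γ^{3^k i}} c♮_{k+1} = res(3 • c♮_k)` for EVERY `k ≥ 0` (temper exactly `1`), by
`…CumulativeKummerTower.exists_cumulativeKummerTower` (p641582) fed with §2 (trace zero, `j₀ = 0`) and the cell's
`E(K_∞)[3^∞] = 0` (p615628). The earlier instantiation `…CumulativeKummerTower.exists_cumulativeKummerTower_on_leopoldtCell`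
consumed the named fact `CornutVatsal2007.exists_heegnerFamily_traceTorsion_of_sq_dvd` for the relations and an
unspecified `j₀`; non-triviality of `z_0` (its clause (ii)) is not claimed here.
[cite: PerrinRiou1987BSMF, §3.4] [cite: Howard2004HeegnerKolyvagin, §1 and §3.3] [cite: CornutVatsal2007, §4.3 Lemma 4.9 (iii)] -/
theorem cell_exists_cumulativeKummerTower_canonical (hO6 : ClassO6 W₀ 3)
    (hline : ∃ Φ : AddSubgroup (WeierstrassCurve.geomTorsion W₀ ((3 : ℕ) : ℤ)),
        Literature.NumberTheory.EllipticCurves.Rank1Residual.IsRationalLine W₀ 3 Φ ∧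
        ∀ (v : IsDedekindDomain.HeightOneSpectrum (NumberField.RingOfIntegers ℚ)),
          ((3 : ℕ) : NumberField.RingOfIntegers ℚ) ∈ v.asIdeal → ∀ 𝔓 ∈ v.primesAbove,
          ¬ (∀ g ∈ 𝔓.decompositionSubgroup (Field.absoluteGaloisGroup ℚ), ∀ P ∈ Φ, g • P = P) ∧
          ¬ (∀ g ∈ 𝔓.decompositionSubgroup (Field.absoluteGaloisGroup ℚ),
              ∀ P : WeierstrassCurve.geomTorsion W₀ ((3 : ℕ) : ℤ), g • P - P ∈ Φ))
    (hN : W₀.conductorNorm ℤ = N₀) (hK : IsImaginaryQuadratic K₀) (hHg : SatisfiesHeegnerHypothesis N₀ K₀)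
    (κ₃ : ZpExtension K₀ 3) {γ₃ : Field.absoluteGaloisGroup K₀} (hγ : κ₃.IsTopGenerator γ₃)
    (Dt : ModularParametrizationData W₀ N₀) {β : ℤ} (hβ : (4 * N₀ : ℤ) ∣ β ^ 2 - NumberField.discr K₀)
    (jbar₀ : AlgebraicClosure K₀ →+* ℂ)
    (hTw : ∀ k : ℕ, ringClassSubgroup K₀ (3 ^ (k + 1)) jbar₀ ≤ κ₃.layerSubgroup k) :
    ∃ (F : HeegnerFamily N₀ W₀ K₀ κ₃ jbar₀) (c : (k : ℕ) → (W₀.baseChange K₀).torsionH1Pi 3 (κ₃.layerSubgroup k)),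
      F.Dt = Dt ∧ F.β = β ∧
      (∀ j : ℕ, ∑ i ∈ Finset.range 3, (γ₃ ^ (3 ^ j * i)) • F.z (j + 1) = 0) ∧
      (∀ k, (W₀.baseChange K₀).IsKummerFamilyOver 3 (κ₃.layerSubgroup k)
        (P := ∑ j ∈ Finset.Icc 0 k, F.z j)
        (fun _ hσ ↦ CumulativeHeegnerInclusionAtThreeCumulativeKummerTower.smul_cumulative_eq F 0 k hσ) (c k)) ∧
      (∀ k, c k ∈ (W₀.baseChange K₀).compactSelmerOver (κ₃.layerSubgroup k) 3) ∧
      (∀ k, ∑ i ∈ Finset.range 3, (W₀.baseChange K₀).conjPi 3 (κ₃.layerSubgroup (k + 1)) (γ₃ ^ (3 ^ k * i)) (c (k + 1)) =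
          (W₀.baseChange K₀).resPi 3 (κ₃.layerSubgroup_antitone (Nat.le_succ k)) ((3 : ℤ) • c k)) := by
  obtain ⟨F, hFDt, hFβ, htr, hTT⟩ := cell_exists_heegnerFamily_trace_eq_zero hO6 hN hK κ₃ hγ Dt hβ jbar₀ hTw
  have hbot := CumulativeHeegnerInclusionAtThreeCellNoThreeTorsion.cell_fixedPoints_kerSubgroup_eq_bot W₀ N₀ K₀ hO6 hline
    hN hK hHg κ₃
  obtain ⟨c, hc, hS, hrel⟩ :=
    CumulativeHeegnerInclusionAtThreeCumulativeKummerTower.exists_cumulativeKummerTower hγ hbot F 0 (fun j _ ↦ hTT j)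
  exact ⟨F, c, hFDt, hFβ, htr, hc, hS, fun k ↦ hrel k (Nat.zero_le k)⟩

/-! ## §5 (appended) The bottom point `z_0 = −y_K` of the canonical family, and ONE family with all relations -/

omit [W₀.IsGloballyMinimal] [NeZero N₀] in
/-- On the cell, `d_K < −4`: `3 ∣ N` splits in `K` (Heegner hypothesis), so `3 ∤ d_K` (`d_K ≠ −3`) and `d_K` is a
square mod `3` (`d_K ≠ −4`); with `d_K ≡ 0, 1 (mod 4)` and `d_K < 0` this forces `d_K ≤ −7`. So `𝒪_K^× = {±1}`.
[cite: Cox2013, §5.B Prop. 5.16] -/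
theorem cell_discr_lt_neg_four (hO6 : ClassO6 W₀ 3) (hN : W₀.conductorNorm ℤ = N₀) (hK : IsImaginaryQuadratic K₀)
    (hHg : SatisfiesHeegnerHypothesis N₀ K₀) : NumberField.discr K₀ < -4 := by
  have hsplit := hHg 3 Nat.prime_three (cell_three_dvd hO6 hN)
  obtain ⟨hndvd, s, hs⟩ := HeegnerTraceSplit.exists_sq_sub_discr_dvd_of_split hK.1 Nat.prime_three (by norm_num) hsplit
  have hneg := hK.discr_neg
  have h4 := Literature.NumberTheory.QuadraticFields.Quadratic.discr_emod_four hK.1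
  have hne3 : NumberField.discr K₀ ≠ -3 := fun h ↦ hndvd (by rw [h]; norm_num)
  have hne4 : NumberField.discr K₀ ≠ -4 := by
    intro h
    rw [h] at hs
    have hz := (ZMod.intCast_zmod_eq_zero_iff_dvd _ 3).mpr hs
    push_cast at hz
    revert hz
    generalize (s : ZMod 3) = t
    revert t
    decide
  omega

/-- **ONE Heegner family on the Leopoldt cell with ALL its vertical relations proved** (modulo the tower containment
`K_k ⊆ K[3^{k+1}]` for the layer traces; the bottom relation needs none): on the cell of crux K1 / A (class O6 at
`3`, non-anomalous rational line, `N = N_E`, `K` imaginary quadratic Heegner for `N`), for every `ℤ₃`-extension `κ`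
with topological generator `γ`, datum `Dt`, orientation `β`, embedding `jbar`, the CANONICAL family `F`
(`exists_heegnerFamily_canonical`) satisfies: `F.Dt = Dt`, `F.β = β`;
**`z_0 = −y_K`** (`HeegnerTraceLevelDividingSplit.z_zero_eq_lFunction_smul_y_sub_y` with `a₃ = 0`: so `z_0`, the
bottom of the cumulative tower `Y_0`, is non-torsion exactly when `y_K` is — Gross–Zagier, not Cornut–Vatsal);
**`Tr_{K_{j+1}/K_j} z_{j+1} = 0` for every `j`** (`HeegnerGeomLevelDividing.sum_range_pow_smul_z_succ_eq_lFunction_smul_z`);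
and **`ℋ_∞(F) = ⊥`** for every `Λ`-adic Selmer datum (`…TraceZero.heegnerModule_eq_bot_on_leopoldtCell`).
[cite: GrossLMS1991, §1 and §3 Prop. 3.7] [cite: CornutVatsal2007, §4.3 Lemma 4.9 (iii)] [cite: PerrinRiou1987BSMF, §3.3–3.4] -/
theorem cell_exists_heegnerFamily_canonical_relations (hO6 : ClassO6 W₀ 3)
    (hline : ∃ Φ : AddSubgroup (WeierstrassCurve.geomTorsion W₀ ((3 : ℕ) : ℤ)),
        Literature.NumberTheory.EllipticCurves.Rank1Residual.IsRationalLine W₀ 3 Φ ∧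
        ∀ (v : IsDedekindDomain.HeightOneSpectrum (NumberField.RingOfIntegers ℚ)),
          ((3 : ℕ) : NumberField.RingOfIntegers ℚ) ∈ v.asIdeal → ∀ 𝔓 ∈ v.primesAbove,
          ¬ (∀ g ∈ 𝔓.decompositionSubgroup (Field.absoluteGaloisGroup ℚ), ∀ P ∈ Φ, g • P = P) ∧
          ¬ (∀ g ∈ 𝔓.decompositionSubgroup (Field.absoluteGaloisGroup ℚ),
              ∀ P : WeierstrassCurve.geomTorsion W₀ ((3 : ℕ) : ℤ), g • P - P ∈ Φ))
    (hN : W₀.conductorNorm ℤ = N₀) (hK : IsImaginaryQuadratic K₀) (hHg : SatisfiesHeegnerHypothesis N₀ K₀)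
    (κ₃ : ZpExtension K₀ 3) {γ₃ : Field.absoluteGaloisGroup K₀} (hγ : κ₃.IsTopGenerator γ₃)
    (Dt : ModularParametrizationData W₀ N₀) {β : ℤ} (hβ : (4 * N₀ : ℤ) ∣ β ^ 2 - NumberField.discr K₀)
    (jbar₀ : AlgebraicClosure K₀ →+* ℂ)
    (hTw : ∀ k : ℕ, ringClassSubgroup K₀ (3 ^ (k + 1)) jbar₀ ≤ κ₃.layerSubgroup k) :
    ∃ F : HeegnerFamily N₀ W₀ K₀ κ₃ jbar₀, F.Dt = Dt ∧ F.β = β ∧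
      F.z 0 = -F.y ∧
      (∀ j : ℕ, ∑ i ∈ Finset.range 3, (γ₃ ^ (3 ^ j * i)) • F.z (j + 1) = 0) ∧
      ∀ D : (W₀.baseChange K₀).LambdaAdicSelmerData κ₃ γ₃, heegnerModule D F = ⊥ := by
  obtain ⟨F, hFDt, hFβ, ⟨x₁, R₀, hx₁, hfix₁, htrans₀, hy⟩, hcan⟩ := exists_heegnerFamily_canonical hK κ₃ Dt hβ jbar₀
  subst hFDt hFβ
  have hap := cell_lFunction_three_eq_zero hO6
  have h3N := cell_three_dvd hO6 hN
  have hz0 : F.z 0 = -F.y := by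
    obtain ⟨xp, R, hxp, hfixp, hRsub, htrans, hz⟩ := hcan 0
    have h := HeegnerTraceLevelDividingSplit.z_zero_eq_lFunction_smul_y_sub_y hK hHg
      (cell_discr_lt_neg_four hO6 hN hK hHg) le_rfl h3N F hx₁ hfix₁ htrans₀ hy hxp hfixp hRsub htrans hz
    rwa [hap, zero_zsmul, zero_sub] at h
  have htr : ∀ j : ℕ, ∑ i ∈ Finset.range 3, (γ₃ ^ (3 ^ j * i)) • F.z (j + 1) = 0 := fun j ↦ by
    obtain ⟨x₁', R₁, hx₁', -, hR₁sub, htrans₁, hz₁⟩ := hcan j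
    obtain ⟨x₂, R, hx₂, hfix₂, hRsub, htrans, hz⟩ := hcan (j + 1)
    rw [HeegnerGeomLevelDividing.sum_range_pow_smul_z_succ_eq_lFunction_smul_z hK hγ h3N F j (hTw j) (hTw (j + 1))
      hx₁' hR₁sub htrans₁ hz₁ hx₂ hfix₂ hRsub htrans hz, hap, zero_zsmul]
  exact ⟨F, rfl, rfl, hz0, htr, fun D ↦ heegnerModule_eq_bot_on_leopoldtCell hO6 hline hN hK hHg hγ D F htr⟩

end Summit.BirchSwinnertonDyer.BirchSwinnertonDyer.Theorems.CumulativeHeegnerInclusionAtThreeCanonicalFamilyTraceZero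

end
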